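import Summits.QuantumFields.BalabanUV.T4Continuum.Support.NE7EffectiveFormCoarseCurlAllLevels
import Summits.QuantumFields.BalabanUV.T4Continuum.Support.NE3SmoothRightInverseBounds
import Summits.QuantumFields.BalabanUV.T4Continuum.Support.AveragingDeficitHSInner
import HarnessLib

/-!
# NE7SmoothRightInverseLevelQ — ROW NE3's EXACT SMOOTH RIGHT INVERSE IS A `levelQ'`-PREIMAGE AT THE FLAT DATUM, AND ITS CURL LETTER IN THE `nhsNormSq` CURRENCY:
# `levelQ' j 1 (res (smoothRightInverse L j ṽ)) = v`, `Σ_{p ∈ perWin (M·N)} nhsNormSq (curl_1 (smoothRightInverse L j φ) p) ≤ 4d·(24·8^{d−1})²·(M^d∕M⁴)·Σ_{z,κ} nhsNormSq (φ z κ)`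

Lineage `b2b-balaban-t4-ne7b-p1` (row NE7b OWNER; junction service for row NE7), generation 160; item (U) «uniform UPPER bound via a right inverse of `levelQ′`» of the
road's memo `t4/b2b-balaban-t4-ne7-p1-g116/ROAD-G116.md` §6 — FOUND IN THE TREE: the NE3 swarm (leaf-01, route Π-R) landed the exact, local, smooth right inverse of the
`(j+1)`-fold linearised average at the flat background, ✓ `NE3SmoothRightInverseFlat.smoothRightInverse` (`cpushIter L j 1 (R φ) = φ`), with the curl letter
✓ `NE3SmoothRightInverseCurl.curlSq_flat_smoothRightInverse_le` (`curlSq ≤ 4d·(24·8^{d−1})²·M^{d−4}·‖φ‖²_{ℓ²}`, `M = L^{j+1}`, NO `∇φ`).  THIS FILE is the dictionary to the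
road's currency: (§1) `levelQ' L N j 1 (resDir φ) = skewPF (resDir (cpushIter L j 1 φ))` as an EQUATION at the flat datum (the tree's ✓ `NE7MultiplierOfRightInverse.coe_levelQ'_resDir`
is the curved-class version; ✓ `AveragingDeficitMultiLevelPrep.levelQ'_resDir_eq_zero` the kernel inclusion), by induction through the tower with ✓ `fderiv_coord_resDir` and
✓ `NE7FlatAverageCurlCommutation.norm_Wcx_flatCfg_sub_one_lt`; (§2) `smoothRightInverse L j ṽ` is skew, `(L·tower L N j)`-periodic, and **`levelQ'_flatCfg_smoothRightInverse`**:
its torus restriction is a `levelQ'`-PREIMAGE of `v`; (§3) the plaquette letter in the normalised Hilbert–Schmidt square (colour-number-free): every transverse unit step moves the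
lift by a REAL SCALAR multiple `s • φ(blk x, κ)` with `|s| ≤ 24·8^{d−1}∕M²` (`smoothLift_step_eq_smul`, the structure behind ✓ `NE3SmoothLiftCurl.norm_smoothLift_step_le`), hence
`nhsNormSq (curl_1 (R φ)(x; μ,ν)) ≤ 2·(24·8^{d−1}∕M²)²·(nhsNormSq φ(blk x, ν) + nhsNormSq φ(blk x, μ))` and **`sum_nhsNormSq_curl_smoothRightInverse_le`** (the display above).
HONEST FRAMING: flat lattice kinematics of OUR objects (row NE3's lift, the road's `levelQ'`); nothing of Bałaban's asserted ([Balaban1984PropagatorsI] (1.20)–(1.21) context only);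
NOT NE7, NOT NE3 as spine nodes; row NE7b NOT touched; spine 0∕9; finite T⁴ rung (B)+1 — NOT infinite volume, NOT mass gap, NOT BetaPertH, NOT Clay.
-/

set_option autoImplicit false

open scoped BigOperators Matrix Matrix.Norms.L2Operator
open Finset

namespace Summit.QuantumFields.BalabanUV.T4Continuum.NE7SmoothRightInverseLevelQ

open Literature.MathematicalPhysics.QuantumFieldTheory.Balaban1983to89
open B7Prop1Explicit B7Prop2Explicit
open T4AveragingDeficitWall (curl curlAt IsSkewDir)
open T4AveragingDeficitWallBoundary (periodBox mem_periodBox card_periodBox)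
open AveragingDeficitPeriodicCounting (IsPeriodicDir)
open AveragingDeficitTorusChart (TDir chartDir resDir redN_boxVec isPeriodicDir_chartDir chartDir_id_resDir)
open AveragingDeficitChartCalculus (coord cavg)
open AveragingDeficitTwoLevelPrep (skewSub skewPF skewPF_of_mem)
open AveragingDeficitMultiLevelPrep (tower levelQ' tower_ne_zero cpush fderiv_coord_resDir isPeriodicDir_cpush)
open ReplicationRightInverse (cpushIter)
open MinimalActionLevels (perWin)
open MinimalActionWitness (flatCfg isPeriodicCfg_flatCfg)
open MatrixNorms (nhsNormSq nhsNormSq_nonneg)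
open AveragingDeficitHSInner (nhsNormSq_smul)
open SmoothRefineBlocks (blk res res_nonneg res_lt blk_add_e res_add_e_self res_add_e_ne)
open SmoothRefineInterp (interp interp_mem)
open NE3TangentNoGoWords (dPot)
open NE3TangentFlatPush (flatCfg_eq_flat cavg_flatCfg)
open NE3TangentFlatStructure (framePot)
open NE3FrameFreeDecompositionPrep (framePot_mem_skewAdjoint)
open NE3TentBump (fac fac_nonneg fac_le_one fac_le_inv_of_res_eq abs_fac_step_le)
open NE3TentBumpSharp (fac_add_e_ne)
open NE3SmoothLiftProfile (lprof abs_lprof_le)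
open NE3SmoothLiftFlat (tperp liftNorm smoothLift liftNorm_pos)
open NE3SmoothLiftBounds (liftNorm_ge smoothLift_of_res_ne_eq_zero)
open NE3SmoothLiftCurl (curlAt_flat_eq tperp_split)
open NE3SpreadLiftCurl (sum_plane_pair_le)
open NE3CoarseInterpolant (blk_block)
open NE3BlockLineAverage (sum_periodBox_blocks)
open NE3SmoothRightInverseFlat (smoothRightInverse cpushIter_flat_smoothRightInverse)
open NE3SmoothRightInverseCurl (curlAt_flat_smoothRightInverse)
open NE3SmoothRightInverseBounds (smoothRightInverse_add_period)
open NE7EffectiveFormCoarseCurlAllLevels (tower_window)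
open NE7FlatAverageCurlCommutation (norm_Wcx_flatCfg_sub_one_lt isSkewDir_chartDir_id)

noncomputable section

variable {d : ℕ} {n : Type} [Fintype n] [DecidableEq n]

/-! ## §1 The dictionary `levelQ' ↔ cpushIter` at the flat datum, as an equation -/

/-- **`levelQ'` IS THE `𝔲(N)` PART OF THE TORUS READING OF `cpushIter` AT THE FLAT DATUM**: for every `(L·tower L N j)`-periodic direction `φ` of `ℤ^d`,
`(levelQ' L N j 1 (resDir φ) : TDir d n N) = skewPF N (resDir N (cpushIter L j 1 φ))` (no smallness hypothesis: at the flat configuration every loop variable is `1`). [folklore] -/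
theorem coe_levelQ'_flatCfg_resDir {L N : ℕ} [NeZero L] [NeZero N] :
    ∀ (j : ℕ) (φ : Site d → Fin d → Matrix n n ℂ), IsPeriodicDir φ ((L * tower L N j : ℕ) : ℤ) →
      ((levelQ' L N j (flatCfg : Site d → Fin d → (Matrix n n ℂ)ˣ) (resDir (L * tower L N j) φ) : ↥(skewSub d n N)) : TDir d n N)
        = skewPF N (resDir N (cpushIter L j (flatCfg : Site d → Fin d → (Matrix n n ℂ)ˣ) φ))
  | 0, φ, hφ => by
      haveI : NeZero (L * N) := ⟨Nat.mul_ne_zero (NeZero.ne L) (NeZero.ne N)⟩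
      have hφ0 : IsPeriodicDir φ ((L * N : ℕ) : ℤ) := hφ
      show skewPF N ((fderiv ℝ (coord (ContinuousLinearMap.id ℝ (Matrix n n ℂ)) L N (flatCfg : Site d → Fin d → (Matrix n n ℂ)ˣ)) 0) (resDir (L * N) φ)) = _
      rw [fderiv_coord_resDir (fun q κ r => norm_Wcx_flatCfg_sub_one_lt L q κ r) hφ0]
      rfl
  | j + 1, φ, hφ => by
      haveI : NeZero (L * tower L N j) := ⟨Nat.mul_ne_zero (NeZero.ne L) (tower_ne_zero L N j)⟩
      haveI : NeZero (L * (L * tower L N j)) := ⟨Nat.mul_ne_zero (NeZero.ne L) (Nat.mul_ne_zero (NeZero.ne L) (tower_ne_zero L N j))⟩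
      have hφ' : IsPeriodicDir φ ((L * (L * tower L N j) : ℕ) : ℤ) := hφ
      have hφ'' : IsPeriodicDir φ ((L : ℤ) * ((L * tower L N j : ℕ) : ℤ)) := by
        have e1 : ((L * (L * tower L N j) : ℕ) : ℤ) = (L : ℤ) * ((L * tower L N j : ℕ) : ℤ) := by push_cast; ring
        rw [e1] at hφ'; exact hφ'
      have hcp : IsPeriodicDir (cpush L (flatCfg : Site d → Fin d → (Matrix n n ℂ)ˣ) φ) ((L * tower L N j : ℕ) : ℤ) :=
        isPeriodicDir_cpush L (L * tower L N j) (isPeriodicCfg_flatCfg _) hφ''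
      show (((levelQ' L N j (cavg L (flatCfg : Site d → Fin d → (Matrix n n ℂ)ˣ))).comp
          (fderiv ℝ (coord (ContinuousLinearMap.id ℝ (Matrix n n ℂ)) L (L * tower L N j) (flatCfg : Site d → Fin d → (Matrix n n ℂ)ˣ)) 0))
            (resDir (L * (L * tower L N j)) φ) : TDir d n N)
        = skewPF N (resDir N (cpushIter L j (cavg L (flatCfg : Site d → Fin d → (Matrix n n ℂ)ˣ))
            (cpush L (flatCfg : Site d → Fin d → (Matrix n n ℂ)ˣ) φ)))
      rw [ContinuousLinearMap.comp_apply, fderiv_coord_resDir (N := L * tower L N j) (fun q κ r => norm_Wcx_flatCfg_sub_one_lt L q κ r) hφ', cavg_flatCfg]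
      exact coe_levelQ'_flatCfg_resDir j _ hcp

/-! ## §2 Row NE3's smooth right inverse as a `levelQ'`-preimage: skew, periodic, exact -/

omit [Fintype n] [DecidableEq n] in
/-- The smooth lift of a skew coarse field is skew (real scalar weights). [folklore] -/
theorem isSkewDir_smoothLift (M : ℕ) {φ : Site d → Fin d → Matrix n n ℂ} (hφ : IsSkewDir φ) : IsSkewDir (smoothLift M φ) := fun x μ => by
  unfold smoothLift
  exact skewAdjoint.smul_mem _ (hφ _ _)

/-- **The smooth right inverse of a skew coarse field is skew**: the lift has real weights, the frame potential of a skew field is skew (✓ `framePot_mem_skewAdjoint`),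
its multilinear interpolant is skew (✓ `interp_mem`), and so is its coboundary. [folklore] -/
theorem isSkewDir_smoothRightInverse (L j : ℕ) {φ : Site d → Fin d → Matrix n n ℂ} (hφ : IsSkewDir φ) : IsSkewDir (smoothRightInverse L j φ) := by
  intro x κ
  have hG : ∀ z : Site d, framePot L (j + 1) (smoothLift (L ^ (j + 1)) φ) z ∈ skewAdjoint (Matrix n n ℂ) :=
    framePot_mem_skewAdjoint L (j + 1) (isSkewDir_smoothLift _ hφ)
  have hI : ∀ y : Site d, interp (L ^ (j + 1)) Finset.univ (framePot L (j + 1) (smoothLift (L ^ (j + 1)) φ)) y ∈ skewAdjoint (Matrix n n ℂ) :=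
    fun y => interp_mem (skewAdjoint (Matrix n n ℂ)) (fun r X hX => skewAdjoint.smul_mem r hX) _ _ hG y
  unfold smoothRightInverse
  simp only [Pi.add_apply, dPot]
  exact (skewAdjoint (Matrix n n ℂ)).add_mem (isSkewDir_smoothLift _ hφ x κ) ((skewAdjoint (Matrix n n ℂ)).sub_mem (hI _) (hI _))

/-- **The smooth right inverse of an `N`-periodic coarse field is `(L·tower L N j)`-periodic** (✓ `smoothRightInverse_add_period`, `L^{j+1}·N = L·tower L N j`). [folklore] -/
theorem isPeriodicDir_smoothRightInverse {L : ℕ} (hL : 1 ≤ L) (j : ℕ) {N : ℕ} {φ : Site d → Fin d → Matrix n n ℂ} (hφ : IsPeriodicDir φ (N : ℤ)) :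
    IsPeriodicDir (smoothRightInverse L j φ) ((L * tower L N j : ℕ) : ℤ) := by
  intro x τ κ
  have h := smoothRightInverse_add_period hL j (N := N) (φ := φ) (fun z τ' κ' => hφ z τ' κ') x τ κ
  have e1 : L ^ (j + 1) * N = L * tower L N j := by rw [tower_window]; ring
  rw [e1] at h
  exact h

omit [Fintype n] [DecidableEq n] in
/-- Restricting the periodic extension of a torus field gives the field back. [folklore] -/
theorem resDir_chartDir_id {N : ℕ} [NeZero N] (ψ : TDir d n N) : resDir N (chartDir (ContinuousLinearMap.id ℝ (Matrix n n ℂ)) N ψ) = ψ := by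
  funext r κ
  simp only [resDir, chartDir, ContinuousLinearMap.coe_id', id, redN_boxVec]

/-- The torus restriction of the smooth right inverse of `ṽ` is a skew torus field. [folklore] -/
theorem resDir_smoothRightInverse_mem {L N : ℕ} [NeZero N] (j : ℕ) (v : ↥(skewSub d n N)) :
    resDir (L * tower L N j) (smoothRightInverse L j (chartDir (ContinuousLinearMap.id ℝ (Matrix n n ℂ)) N (v : TDir d n N))) ∈ skewSub d n (L * tower L N j) :=
  fun r κ => isSkewDir_smoothRightInverse L j (isSkewDir_chartDir_id v.2) (boxVec (L * tower L N j) r) κ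

/-- **THE SMOOTH RIGHT INVERSE IS A `levelQ'`-PREIMAGE AT THE FLAT DATUM**: for every `L ≥ 2`, every level `j`, every `N` and every `v ∈ skewSub d n N`,
`levelQ' L N j 1 (resDir (L·tower L N j) (smoothRightInverse L j ṽ)) = v`, `ṽ = chartDir id N v` (§1 + ✓ `cpushIter_flat_smoothRightInverse`). [folklore] -/
theorem levelQ'_flatCfg_smoothRightInverse {L N : ℕ} [NeZero L] [NeZero N] (hL : 2 ≤ L) (j : ℕ) (v : ↥(skewSub d n N)) :
    levelQ' L N j (flatCfg : Site d → Fin d → (Matrix n n ℂ)ˣ)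
        (resDir (L * tower L N j) (smoothRightInverse L j (chartDir (ContinuousLinearMap.id ℝ (Matrix n n ℂ)) N (v : TDir d n N)))) = v := by
  have hL1 : 1 ≤ L := by omega
  apply Subtype.ext
  rw [coe_levelQ'_flatCfg_resDir j _ (isPeriodicDir_smoothRightInverse hL1 j (isPeriodicDir_chartDir _ N (v : TDir d n N))), flatCfg_eq_flat,
    cpushIter_flat_smoothRightInverse hL j, resDir_chartDir_id]
  exact skewPF_of_mem v.2

/-- The periodic extension of the torus restriction of the smooth right inverse is the smooth right inverse. [folklore] -/
theorem chartDir_resDir_smoothRightInverse {L N : ℕ} [NeZero L] [NeZero N] (j : ℕ) (v : ↥(skewSub d n N)) :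
    chartDir (ContinuousLinearMap.id ℝ (Matrix n n ℂ)) (L * tower L N j)
        (resDir (L * tower L N j) (smoothRightInverse L j (chartDir (ContinuousLinearMap.id ℝ (Matrix n n ℂ)) N (v : TDir d n N))))
      = smoothRightInverse L j (chartDir (ContinuousLinearMap.id ℝ (Matrix n n ℂ)) N (v : TDir d n N)) :=
  chartDir_id_resDir _ (isPeriodicDir_smoothRightInverse (Nat.one_le_iff_ne_zero.mpr (NeZero.ne L)) j (isPeriodicDir_chartDir _ N (v : TDir d n N)))

/-! ## §3 The curl letter of the smooth right inverse in the `nhsNormSq` currency -/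

omit [Fintype n] [DecidableEq n] in
/-- **A TRANSVERSE UNIT STEP MOVES THE LIFT BY A REAL SCALAR MULTIPLE OF THE BLOCK DATUM** (`M ≥ 2`, `d ≥ 1`, `α ≠ κ`):
`smoothLift M φ (x + e_α) κ − smoothLift M φ x κ = s • φ (blk M x) κ` with `|s| ≤ 24·8^{d−1}∕M²` (the structure behind ✓ `NE3SmoothLiftCurl.norm_smoothLift_step_le`). [folklore] -/
theorem smoothLift_step_eq_smul {M : ℕ} (hM : 2 ≤ M) (hd : 1 ≤ d) (φ : Site d → Fin d → Matrix n n ℂ) (x : Site d) {α κ : Fin d} (hne : α ≠ κ) :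
    ∃ s : ℝ, |s| ≤ 24 * (8 : ℝ) ^ (d - 1) / (M : ℝ) ^ 2 ∧ smoothLift M φ (x + e α) κ - smoothLift M φ x κ = s • φ (blk M x) κ := by
  have hM1 : 1 ≤ M := by omega
  have hM0 : (0 : ℝ) < M := by exact_mod_cast (by omega : 0 < M)
  have hc := liftNorm_pos hM d
  have hcge := liftNorm_ge hM d hd
  have hg : |lprof M (res M x κ)| ≤ M := abs_lprof_le hM1 (res_nonneg hM1 x κ) (res_lt hM1 x κ).le
  have hkey : (liftNorm d M)⁻¹ * ((M : ℝ) * (1 / M)) ≤ 24 * (8 : ℝ) ^ (d - 1) / (M : ℝ) ^ 2 := by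
    rw [mul_one_div_cancel hM0.ne', mul_one, inv_le_comm₀ hc (by positivity), inv_div]
    exact hcge
  have hP0 : ∀ y : Site d, 0 ≤ ∏ j ∈ (Finset.univ.erase κ).erase α, fac M y j := fun y => Finset.prod_nonneg fun j _ => fac_nonneg hM1 y j
  have hP1 : ∀ y : Site d, ∏ j ∈ (Finset.univ.erase κ).erase α, fac M y j ≤ 1 :=
    fun y => Finset.prod_le_one (fun j _ => fac_nonneg hM1 y j) fun j _ => fac_le_one hM1 y j
  by_cases hface : res M x α = (M : ℤ) - 1
  · -- across the face: the lift at `x + e α` vanishes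
    have hr0 : res M (x + e α) α = 0 := by rw [res_add_e_self hM1, if_pos hface]
    refine ⟨-((liftNorm d M)⁻¹ * (lprof M (res M x κ) * tperp M κ x)), ?_, ?_⟩
    · rw [abs_neg, abs_mul, abs_mul, abs_of_pos (inv_pos.mpr hc), tperp_split M hne, abs_of_nonneg (mul_nonneg (fac_nonneg hM1 x α) (hP0 x))]
      have hfa : fac M x α * ∏ j ∈ (Finset.univ.erase κ).erase α, fac M x j ≤ 1 / M :=
        (mul_le_mul (fac_le_inv_of_res_eq hM1 hface) (hP1 x) (hP0 x) (by positivity)).trans (le_of_eq (mul_one _))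
      calc (liftNorm d M)⁻¹ * (|lprof M (res M x κ)| * (fac M x α * ∏ j ∈ (Finset.univ.erase κ).erase α, fac M x j))
          ≤ (liftNorm d M)⁻¹ * ((M : ℝ) * (1 / M)) :=
            mul_le_mul_of_nonneg_left (mul_le_mul hg hfa (mul_nonneg (fac_nonneg hM1 x α) (hP0 x)) hM0.le) (inv_nonneg.mpr hc.le)
        _ ≤ _ := hkey
    · rw [smoothLift_of_res_ne_eq_zero M φ hne hr0, zero_sub, neg_smul]
      rfl
  · -- inside the block: same block, same `res_κ`, only `fac_α` moves
    have hblk : blk M (x + e α) = blk M x := by rw [blk_add_e hM1, if_neg hface, add_zero]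
    have hresκ : res M (x + e α) κ = res M x κ := res_add_e_ne hM1 x hne.symm
    have hprod : ∏ j ∈ (Finset.univ.erase κ).erase α, fac M (x + e α) j = ∏ j ∈ (Finset.univ.erase κ).erase α, fac M x j :=
      Finset.prod_congr rfl fun j hj => fac_add_e_ne hM1 x (Finset.ne_of_mem_erase hj)
    refine ⟨(liftNorm d M)⁻¹ * (lprof M (res M x κ) * ((fac M (x + e α) α - fac M x α) * ∏ j ∈ (Finset.univ.erase κ).erase α, fac M x j)), ?_, ?_⟩
    · rw [abs_mul, abs_mul, abs_mul, abs_of_pos (inv_pos.mpr hc), abs_of_nonneg (hP0 x)]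
      have hstep := abs_fac_step_le hM1 hface
      calc (liftNorm d M)⁻¹ * (|lprof M (res M x κ)| * (|fac M (x + e α) α - fac M x α| * ∏ j ∈ (Finset.univ.erase κ).erase α, fac M x j))
          ≤ (liftNorm d M)⁻¹ * ((M : ℝ) * (1 / M)) := by
            refine mul_le_mul_of_nonneg_left (mul_le_mul hg ?_ (mul_nonneg (abs_nonneg _) (hP0 x)) hM0.le) (inv_nonneg.mpr hc.le)
            exact (mul_le_mul hstep (hP1 x) (hP0 x) (by positivity)).trans (le_of_eq (mul_one _))
        _ ≤ _ := hkey
    · unfold smoothLift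
      rw [hblk, hresκ, tperp_split M hne, tperp_split M hne, hprod, ← sub_smul]
      congr 1
      ring

omit [DecidableEq n] in
/-- **`nhsNormSq` STEP LETTER**: `nhsNormSq (smoothLift M φ (x + e_α) κ − smoothLift M φ x κ) ≤ (24·8^{d−1}∕M²)²·nhsNormSq (φ (blk M x) κ)` (`α ≠ κ`). [folklore] -/
theorem nhsNormSq_smoothLift_step_le {M : ℕ} (hM : 2 ≤ M) (hd : 1 ≤ d) (φ : Site d → Fin d → Matrix n n ℂ) (x : Site d) {α κ : Fin d} (hne : α ≠ κ) :
    nhsNormSq (smoothLift M φ (x + e α) κ - smoothLift M φ x κ) ≤ (24 * (8 : ℝ) ^ (d - 1) / (M : ℝ) ^ 2) ^ 2 * nhsNormSq (φ (blk M x) κ) := by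
  obtain ⟨s, hs, heq⟩ := smoothLift_step_eq_smul hM hd φ x hne
  rw [heq, nhsNormSq_smul, ← sq_abs]
  exact mul_le_mul_of_nonneg_right (pow_le_pow_left₀ (abs_nonneg s) hs 2) (nhsNormSq_nonneg _)

omit [DecidableEq n] in
/-- `nhsNormSq (X − Y) ≤ 2·(nhsNormSq X + nhsNormSq Y)`. [folklore] -/
theorem nhsNormSq_sub_le_two (X Y : Matrix n n ℂ) : nhsNormSq (X - Y) ≤ 2 * (nhsNormSq X + nhsNormSq Y) := by
  unfold nhsNormSq
  rw [← add_div, mul_div_assoc']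
  refine div_le_div_of_nonneg_right ?_ (Nat.cast_nonneg _)
  rw [← Finset.sum_add_distrib, Finset.mul_sum]
  refine Finset.sum_le_sum fun i _ => ?_
  rw [← Finset.sum_add_distrib, Finset.mul_sum]
  refine Finset.sum_le_sum fun j _ => ?_
  rw [Matrix.sub_apply]
  nlinarith [norm_sub_le (X i j) (Y i j), norm_nonneg (X i j - Y i j), norm_nonneg (X i j), norm_nonneg (Y i j),
    sq_nonneg (‖X i j‖ - ‖Y i j‖)]

/-- **THE FLAT CURL OF THE LIFT, PLAQUETTE BY PLAQUETTE, `nhsNormSq` currency** (`μ ≠ ν`):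
`nhsNormSq (curlAt 1 (smoothLift M φ) x μ ν) ≤ 2·(24·8^{d−1}∕M²)²·(nhsNormSq φ(blk x, ν) + nhsNormSq φ(blk x, μ))`. [folklore] -/
theorem nhsNormSq_curlAt_flat_smoothLift_le {M : ℕ} (hM : 2 ≤ M) (hd : 1 ≤ d) (φ : Site d → Fin d → Matrix n n ℂ) (x : Site d) {μ ν : Fin d}
    (hμν : μ ≠ ν) :
    nhsNormSq (curlAt (BlockAveragePushDirSplit.flat (d := d) (n := n)) (smoothLift M φ) x μ ν)
      ≤ 2 * (24 * (8 : ℝ) ^ (d - 1) / (M : ℝ) ^ 2) ^ 2 * (nhsNormSq (φ (blk M x) ν) + nhsNormSq (φ (blk M x) μ)) := by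
  rw [curlAt_flat_eq, mul_add]
  refine (nhsNormSq_sub_le_two _ _).trans ?_
  rw [mul_add, mul_assoc, mul_assoc]
  exact add_le_add (mul_le_mul_of_nonneg_left (nhsNormSq_smoothLift_step_le hM hd φ x hμν) (by norm_num))
    (mul_le_mul_of_nonneg_left (nhsNormSq_smoothLift_step_le hM hd φ x (Ne.symm hμν)) (by norm_num))

/-- The period-window curl energy as a box-and-plane double sum of `curlAt`. [folklore] -/
theorem sum_perWin_nhsNormSq_curl' (P : ℕ) (V : Site d → Fin d → (Matrix n n ℂ)ˣ) (Y : Site d → Fin d → Matrix n n ℂ) :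
    ∑ p ∈ perWin d P, nhsNormSq (curl V Y p) = ∑ x ∈ periodBox P, ∑ π : T4AveragingDeficitWall.Plane d, nhsNormSq (curlAt V Y x π.1.1 π.1.2) := by
  rw [perWin, Finset.sum_product]
  rfl

/-- **THE `nhsNormSq` CURL LETTER OF THE SMOOTH LIFT** (`M ≥ 2`, `d ≥ 1`, any `N`):
`Σ_{p ∈ perWin (M·N)} nhsNormSq (curl_1 (smoothLift M φ) p) ≤ 4d·(24·8^{d−1})²·(M^d∕M⁴)·Σ_{z ∈ periodBox N} Σ_κ nhsNormSq (φ z κ)` — colour-number-free, NO `∇φ`. [folklore] -/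
theorem sum_nhsNormSq_curl_smoothLift_le [Nonempty n] {M : ℕ} (hM : 2 ≤ M) (hd : 1 ≤ d) (N : ℕ) (φ : Site d → Fin d → Matrix n n ℂ) :
    ∑ p ∈ perWin d (M * N), nhsNormSq (curl (BlockAveragePushDirSplit.flat (d := d) (n := n)) (smoothLift M φ) p)
      ≤ 4 * (d : ℝ) * (24 * (8 : ℝ) ^ (d - 1)) ^ 2 * ((M : ℝ) ^ d / (M : ℝ) ^ 4) * ∑ z ∈ periodBox (d := d) N, ∑ κ : Fin d, nhsNormSq (φ z κ) := by
  have hM1 : 1 ≤ M := by omega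
  have hM0 : (0 : ℝ) < M := by exact_mod_cast (by omega : 0 < M)
  set C : ℝ := 24 * (8 : ℝ) ^ (d - 1) / (M : ℝ) ^ 2 with hC
  have hsite : ∀ x : Site d, ∑ π : T4AveragingDeficitWall.Plane d,
      nhsNormSq (curlAt (BlockAveragePushDirSplit.flat (d := d) (n := n)) (smoothLift M φ) x π.1.1 π.1.2)
        ≤ 2 * C ^ 2 * (2 * d * ∑ κ : Fin d, nhsNormSq (φ (blk M x) κ)) := by
    intro x
    calc ∑ π : T4AveragingDeficitWall.Plane d, nhsNormSq (curlAt (BlockAveragePushDirSplit.flat (d := d) (n := n)) (smoothLift M φ) x π.1.1 π.1.2)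
        ≤ ∑ π : T4AveragingDeficitWall.Plane d, 2 * C ^ 2 * (nhsNormSq (φ (blk M x) π.1.1) + nhsNormSq (φ (blk M x) π.1.2)) :=
          Finset.sum_le_sum fun π _ => by
            rw [add_comm (nhsNormSq (φ (blk M x) π.1.1))]
            exact nhsNormSq_curlAt_flat_smoothLift_le hM hd φ x (ne_of_lt π.2)
      _ = 2 * C ^ 2 * ∑ π : T4AveragingDeficitWall.Plane d, (nhsNormSq (φ (blk M x) π.1.1) + nhsNormSq (φ (blk M x) π.1.2)) := by
          rw [Finset.mul_sum]
      _ ≤ 2 * C ^ 2 * (2 * d * ∑ κ : Fin d, nhsNormSq (φ (blk M x) κ)) :=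
          mul_le_mul_of_nonneg_left (sum_plane_pair_le (h := fun κ => nhsNormSq (φ (blk M x) κ)) fun κ => nhsNormSq_nonneg _) (by positivity)
  rw [sum_perWin_nhsNormSq_curl']
  calc ∑ x ∈ periodBox (d := d) (M * N), ∑ π : T4AveragingDeficitWall.Plane d,
        nhsNormSq (curlAt (BlockAveragePushDirSplit.flat (d := d) (n := n)) (smoothLift M φ) x π.1.1 π.1.2)
      ≤ ∑ x ∈ periodBox (d := d) (M * N), 2 * C ^ 2 * (2 * d * ∑ κ : Fin d, nhsNormSq (φ (blk M x) κ)) := Finset.sum_le_sum fun x _ => hsite x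
    _ = (M : ℝ) ^ d * ∑ z ∈ periodBox (d := d) N, 2 * C ^ 2 * (2 * d * ∑ κ : Fin d, nhsNormSq (φ z κ)) := by
        rw [← sum_periodBox_blocks M N hM1, Finset.mul_sum]
        refine Finset.sum_congr rfl fun z _ => ?_
        rw [Finset.sum_congr rfl fun v hv => by rw [blk_block hM1 z hv], Finset.sum_const, card_periodBox, nsmul_eq_mul, Nat.cast_pow]
    _ = 4 * (d : ℝ) * (24 * (8 : ℝ) ^ (d - 1)) ^ 2 * ((M : ℝ) ^ d / (M : ℝ) ^ 4) * ∑ z ∈ periodBox (d := d) N, ∑ κ : Fin d, nhsNormSq (φ z κ) := by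
        rw [← Finset.mul_sum, ← Finset.mul_sum, hC]
        field_simp
        ring

/-- **THE `nhsNormSq` CURL LETTER OF THE SMOOTH RIGHT INVERSE** (`L ≥ 2`, `d ≥ 1`, `M = L^{j+1}`, any `N`; the corrector is a coboundary, ✓ `curlAt_flat_smoothRightInverse`):
`Σ_{p ∈ perWin (M·N)} nhsNormSq (curl_1 (smoothRightInverse L j φ) p) ≤ 4d·(24·8^{d−1})²·(M^d∕M⁴)·Σ_{z ∈ periodBox N} Σ_κ nhsNormSq (φ z κ)`. [folklore] -/
theorem sum_nhsNormSq_curl_smoothRightInverse_le [Nonempty n] {L : ℕ} (hL : 2 ≤ L) (hd : 1 ≤ d) (j N : ℕ) (φ : Site d → Fin d → Matrix n n ℂ) :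
    ∑ p ∈ perWin d (L ^ (j + 1) * N), nhsNormSq (curl (flatCfg : Site d → Fin d → (Matrix n n ℂ)ˣ) (smoothRightInverse L j φ) p)
      ≤ 4 * (d : ℝ) * (24 * (8 : ℝ) ^ (d - 1)) ^ 2 * ((((L ^ (j + 1) : ℕ) : ℝ)) ^ d / (((L ^ (j + 1) : ℕ) : ℝ)) ^ 4)
          * ∑ z ∈ periodBox (d := d) N, ∑ κ : Fin d, nhsNormSq (φ z κ) := by
  have hM2 : 2 ≤ L ^ (j + 1) := by
    calc 2 ≤ L := hL
      _ = L ^ 1 := (pow_one L).symm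
      _ ≤ L ^ (j + 1) := Nat.pow_le_pow_right (by omega) (by omega)
  have heq : ∀ p ∈ perWin d (L ^ (j + 1) * N), nhsNormSq (curl (flatCfg : Site d → Fin d → (Matrix n n ℂ)ˣ) (smoothRightInverse L j φ) p)
      = nhsNormSq (curl (BlockAveragePushDirSplit.flat (d := d) (n := n)) (smoothLift (L ^ (j + 1)) φ) p) := by
    intro p _
    rw [flatCfg_eq_flat]
    unfold curl
    rw [curlAt_flat_smoothRightInverse]
  rw [Finset.sum_congr rfl heq]
  exact sum_nhsNormSq_curl_smoothLift_le hM2 hd N φ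

end

end Summit.QuantumFields.BalabanUV.T4Continuum.NE7SmoothRightInverseLevelQ
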